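import Summits.BirchSwinnertonDyer.BirchSwinnertonDyer.Theorems.ManinLocalTwoThreeTranslationNormalizer
import Literature.NumberTheory.EllipticCurves.AtkinLehnerInvolutionsNewformProofs
import Summits.BirchSwinnertonDyer.BirchSwinnertonDyer.Theorems.ManinLocalTwoThreeManinThreeKummerCubeArith
import HarnessLib

/-!
# `q`-expansions of `t f` and `R₃ f`; for the newform of a curve, `t f = −f` (`4 ∣ N`) and `R₃ f = −f` (`9 ∣ N`);
# hence the newform lies in the Conway-stable lattice `S^G` and in the Ramanujan-stable lattice `S^R`

Summit `BirchSwinnertonDyer`, route `ManinLocalTwoThree` (cell bsd-f2-manin), cruxes C2 `ManinOddAtFour`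
(stmt-BirchSwinnertonDyer-22967) / C3 `ManinPrimeToThreeAtNine` (stmt-BirchSwinnertonDyer-22968); desc's Conway and
Ramanujan cuts (`Rank1Residual/ManinAdditive/ConwayCut.lean`, `RamanujanCut.lean`; MEMO-desc §22).  This file supplies
the input «`a₂ = 0 ⇒ t f = −f`», «`a₃ = 0 ⇒ R₃ f = −f`» of refuter-1 §R53 P7 and the consequence `ℤf ≤ S^G`, `ℤf ≤ S^R`:

* §3 `cuspCoeff_halfTranslate_two` — `aₙ(t f) = (−1)ⁿ aₙ(f)`; `cuspCoeff_ramanujanThree_two` —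
  `aₙ(R₃ f) = (ζ₃ⁿ + ζ₃²ⁿ) aₙ(f)` (`f(τ + x) = ∑ aₙ e^{2πinx} qⁿ` and uniqueness of `q`-expansions, Mathlib
  `ModularFormClass.qExpansion_coeff_unique`, tree `qParam_vadd`);
* §4 (inputs: the tree's `lFunction_eq_zero_of_even` and its `p = 3` twin `lFunction_eq_zero_of_three_dvd`)
  **`halfTranslate_two_newform`** `t D.f = −D.f` (`4 ∣ N`) and
  **`ramanujanThree_two_newform`** `R₃ D.f = −D.f` (`9 ∣ N`) for every parametrisation datum `D` (q-expansion
  principle `eq_of_forall_cuspCoeff_eq_gamma0`); **`f_mem_conwayStableLattice`**, **`f_mem_ramanujanStableLattice`**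
  (`ℤf` is integral, `w_{Q_p}`-stable by the tree theorem `IsNewform0.exists_atkinLehnerInvolutionAt_eq_smul_holds`
  — Knapp 9.27(b) — and `t`- resp. `R₃`-stable).

No new definitions, no named fact, no sorry.  Nothing about BSD or Manin's conjecture is proved here.

References: A. O. L. Atkin, J. Lehner, Math. Ann. 185 (1970), Thm. 3 (`p² ∣ N ⇒ a_p = 0`) and §4
[cite: AtkinLehner1970, Thm. 3 and §4]; F. Diamond, J. Shurman, *A First Course in Modular Forms*, §1.1, §5.8, (8.44)
[cite: DiamondShurman2005, §5.8]; A. W. Knapp, *Elliptic Curves* (1993), Thm. 9.27(b).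
-/

set_option linter.dupNamespace false

noncomputable section

open scoped MatrixGroups ModularForm Real

open CongruenceSubgroup Matrix.SpecialLinearGroup UpperHalfPlane Complex Matrix.GeneralLinearGroup
  Literature.NumberTheory.EllipticCurves.ModularForms
  Summit.BirchSwinnertonDyer.Rank1Residual.ManinAdditive
  Summit.BirchSwinnertonDyer.Rank1Residual.ManinAdditive.ConwayCut
  Summit.BirchSwinnertonDyer.Rank1Residual.ManinAdditive.RamanujanCut

namespace Summit.BirchSwinnertonDyer.BirchSwinnertonDyer.Theorems.ManinLocalTwoThree

/-! ### §3. `q`-expansions: `aₙ(t f) = (−1)ⁿ aₙ(f)`, `aₙ(R₃ f) = (ζ₃ⁿ + ζ₃²ⁿ) aₙ(f)` -/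

section QExp

variable {N : ℕ} [NeZero N]

/-- **`aₙ(t f) = (−1)ⁿ aₙ(f)`** (`4 ∣ N`, weight `2`): `f(τ + ½) = ∑ aₙ e^{πin} qⁿ` and uniqueness of
`q`-expansions (Mathlib `ModularFormClass.qExpansion_coeff_unique`). [cite: DiamondShurman2005, §1.1 and §5.8] -/
theorem cuspCoeff_halfTranslate_two (h4 : 4 ∣ N) (f : CuspForm (Gamma0 N) 2) (n : ℕ) :
    cuspCoeff (halfTranslate N 2 f) n = (-1) ^ n * cuspCoeff f n := by
  have hΓ : (1 : ℝ) ∈ (Gamma0 N : Subgroup (GL (Fin 2) ℝ)).strictPeriods :=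
    strictWidthInfty_Gamma0 N ▸ Subgroup.strictWidthInfty_mem_strictPeriods _
  haveI : Fact (IsCusp OnePoint.infty (Gamma0 N : Subgroup (GL (Fin 2) ℝ))) :=
    ⟨Subgroup.isCusp_of_mem_strictPeriods one_pos hΓ⟩
  have e2 : cexp (2 * π * Complex.I * ((((1 : ℤ) : ℝ) / (2 : ℕ) : ℝ) : ℂ)) = -1 := by
    rw [show (2 * π * Complex.I * ((((1 : ℤ) : ℝ) / (2 : ℕ) : ℝ) : ℂ)) = π * Complex.I by push_cast; ring]
    exact Complex.exp_pi_mul_I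
  have hsum : ∀ τ : ℍ, HasSum (fun m : ℕ ↦ ((-1) ^ m * cuspCoeff f m) •
      Function.Periodic.qParam 1 (τ : ℂ) ^ m) (halfTranslate N 2 f τ) := by
    intro τ
    have h := UpperHalfPlane.hasSum_qExpansion one_pos
      (SlashInvariantFormClass.periodic_comp_ofComplex f hΓ) (ModularFormClass.holo f)
      (ModularFormClass.bdd_at_infty f) (((((1 : ℤ) : ℝ) / (2 : ℕ) : ℝ)) +ᵥ τ)
    rw [halfTranslate_two_apply h4]
    convert h using 2 with m
    rw [qParam_vadd, e2, mul_pow, smul_eq_mul, smul_eq_mul, cuspCoeff]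
    ring
  rw [cuspCoeff, ← ModularFormClass.qExpansion_coeff_unique one_pos hΓ hsum n]

/-- `ζ₃ = e^{2πi/3}` is a primitive cube root of unity. -/
private theorem isPrimitiveRoot_zeta3 :
    IsPrimitiveRoot (cexp (2 * π * Complex.I * (((((1 : ℕ) : ℤ) : ℝ) / (3 : ℕ) : ℝ) : ℂ))) 3 := by
  have h := Complex.isPrimitiveRoot_exp 3 (by norm_num)
  convert h using 2
  push_cast
  ring

/-- **`aₙ(R₃ f) = (ζ₃ⁿ + ζ₃²ⁿ) aₙ(f)`** (`9 ∣ N`, weight `2`), `ζ₃ = e^{2πi/3}`.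
[cite: DiamondShurman2005, §1.1 and §5.8] -/
theorem cuspCoeff_ramanujanThree_two (h9 : 9 ∣ N) (f : CuspForm (Gamma0 N) 2) (n : ℕ) :
    cuspCoeff (ramanujanThree N 2 f) n =
      (cexp (2 * π * Complex.I * (((((1 : ℕ) : ℤ) : ℝ) / (3 : ℕ) : ℝ) : ℂ)) ^ n +
        (cexp (2 * π * Complex.I * (((((1 : ℕ) : ℤ) : ℝ) / (3 : ℕ) : ℝ) : ℂ)) ^ 2) ^ n) * cuspCoeff f n := by
  have hΓ : (1 : ℝ) ∈ (Gamma0 N : Subgroup (GL (Fin 2) ℝ)).strictPeriods :=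
    strictWidthInfty_Gamma0 N ▸ Subgroup.strictWidthInfty_mem_strictPeriods _
  haveI : Fact (IsCusp OnePoint.infty (Gamma0 N : Subgroup (GL (Fin 2) ℝ))) :=
    ⟨Subgroup.isCusp_of_mem_strictPeriods one_pos hΓ⟩
  set ζ : ℂ := cexp (2 * π * Complex.I * (((((1 : ℕ) : ℤ) : ℝ) / (3 : ℕ) : ℝ) : ℂ)) with hζ
  have e23 : cexp (2 * π * Complex.I * (((((2 : ℕ) : ℤ) : ℝ) / (3 : ℕ) : ℝ) : ℂ)) = ζ ^ 2 := by
    rw [hζ, ← Complex.exp_nat_mul]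
    congr 1
    push_cast
    ring
  have hsum : ∀ τ : ℍ, HasSum (fun m : ℕ ↦ ((ζ ^ m + (ζ ^ 2) ^ m) * cuspCoeff f m) •
      Function.Periodic.qParam 1 (τ : ℂ) ^ m) (ramanujanThree N 2 f τ) := by
    intro τ
    have h1 := UpperHalfPlane.hasSum_qExpansion one_pos
      (SlashInvariantFormClass.periodic_comp_ofComplex f hΓ) (ModularFormClass.holo f)
      (ModularFormClass.bdd_at_infty f) (((((1 : ℕ) : ℤ) : ℝ) / (3 : ℕ) : ℝ) +ᵥ τ)
    have h2 := UpperHalfPlane.hasSum_qExpansion one_pos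
      (SlashInvariantFormClass.periodic_comp_ofComplex f hΓ) (ModularFormClass.holo f)
      (ModularFormClass.bdd_at_infty f) (((((2 : ℕ) : ℤ) : ℝ) / (3 : ℕ) : ℝ) +ᵥ τ)
    rw [ramanujanThree_two_apply h9]
    convert h1.add h2 using 1
    funext m
    rw [qParam_vadd, qParam_vadd, ← hζ, e23, mul_pow, mul_pow, smul_eq_mul, smul_eq_mul, smul_eq_mul,
      cuspCoeff]
    ring
  rw [cuspCoeff, ← ModularFormClass.qExpansion_coeff_unique one_pos hΓ hsum n]

/-- `ζ₃ⁿ + ζ₃²ⁿ = −1` for `3 ∤ n`. -/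
private theorem zeta3_pow_add_pow {ζ : ℂ} (hζ : IsPrimitiveRoot ζ 3) {n : ℕ} (hn : ¬ 3 ∣ n) :
    ζ ^ n + (ζ ^ 2) ^ n = -1 := by
  have h3 : ζ ^ 3 = 1 := hζ.pow_eq_one
  have hsum : 1 + ζ + ζ ^ 2 = 0 := by
    have := hζ.geom_sum_eq_zero (by norm_num : 1 < 3)
    simpa [Finset.sum_range_succ, add_assoc] using this
  have hmod : ζ ^ n = ζ ^ (n % 3) := by
    conv_lhs => rw [← Nat.div_add_mod n 3, pow_add, pow_mul, h3, one_pow, one_mul]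
  rw [← pow_mul, show 2 * n = n + n from two_mul n, pow_add, hmod]
  have hr : n % 3 = 1 ∨ n % 3 = 2 := by omega
  rcases hr with hr | hr <;> rw [hr]
  · linear_combination hsum
  · linear_combination hsum + ζ * h3

end QExp

/-! ### §4. Newforms at `4 ∣ N` / `9 ∣ N`: `t f = −f`, `R₃ f = −f`; membership in `S^G`, `S^R` -/

section Newform

variable {N : ℕ} [NeZero N] {W : WeierstrassCurve ℚ} [W.IsElliptic]

/-- **`t f = −f` for the newform of a curve at a level `4 ∣ N`** (all even coefficients vanish).
[cite: AtkinLehner1970, Thm. 3 and §4] -/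
theorem halfTranslate_two_newform (h4 : 4 ∣ N) (D : ModularParametrizationData W N) :
    halfTranslate N 2 D.f = -D.f := by
  have hΓ : (1 : ℝ) ∈ (Gamma0 N : Subgroup (GL (Fin 2) ℝ)).strictPeriods :=
    strictWidthInfty_Gamma0 N ▸ Subgroup.strictWidthInfty_mem_strictPeriods _
  obtain ⟨h2, hN⟩ := lFunction_two_eq_zero_of_four_dvd W D.isNewformOf h4
  refine eq_of_forall_cuspCoeff_eq_gamma0 fun n ↦ ?_
  rw [cuspCoeff_halfTranslate_two h4, cuspCoeff_neg_form hΓ]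
  rcases Nat.even_or_odd n with he | ho
  · rcases eq_or_ne n 0 with rfl | hn0
    · rw [cuspCoeff, CuspFormClass.qExpansion_coeff_zero D.f one_pos hΓ]; ring
    · rw [D.isNewformOf.2 n, lFunction_eq_zero_of_even W h2 hN hn0 (even_iff_two_dvd.mp he)]
      push_cast; ring
  · rw [ho.neg_one_pow]; ring

/-- **`R₃ f = −f` for the newform of a curve at a level `9 ∣ N`** (`a₃ₘ = 0`, `ζ₃ⁿ + ζ₃²ⁿ = −1` for `3 ∤ n`).
[cite: AtkinLehner1970, Thm. 3 and §4] -/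
theorem ramanujanThree_two_newform (h9 : 9 ∣ N) (D : ModularParametrizationData W N) :
    ramanujanThree N 2 D.f = -D.f := by
  have hΓ : (1 : ℝ) ∈ (Gamma0 N : Subgroup (GL (Fin 2) ℝ)).strictPeriods :=
    strictWidthInfty_Gamma0 N ▸ Subgroup.strictWidthInfty_mem_strictPeriods _
  obtain ⟨h3, hN⟩ := lFunction_three_eq_zero_of_nine_dvd W D.isNewformOf h9
  refine eq_of_forall_cuspCoeff_eq_gamma0 fun n ↦ ?_
  rw [cuspCoeff_ramanujanThree_two h9, cuspCoeff_neg_form hΓ]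
  by_cases hn : 3 ∣ n
  · rcases eq_or_ne n 0 with rfl | hn0
    · rw [cuspCoeff, CuspFormClass.qExpansion_coeff_zero D.f one_pos hΓ]; ring
    · rw [D.isNewformOf.2 n, lFunction_eq_zero_of_three_dvd W h3 hN hn0 hn]
      push_cast; ring
  · rw [zeta3_pow_add_pow isPrimitiveRoot_zeta3 hn]; ring

/-- **The newform lies in the Conway-stable lattice `S^G`** (`4 ∣ N`): `ℤf` is integral, `w_{Q_p}`-stable
(Knapp 9.27(b), tree theorem `IsNewform0.exists_atkinLehnerInvolutionAt_eq_smul_holds`) and `t`-stable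
(`t f = −f`). -/
theorem f_mem_conwayStableLattice (h4 : 4 ∣ N) (D : ModularParametrizationData W N) :
    D.f ∈ conwayStableLattice N := by
  have hspan : (ℤ ∙ D.f) ≤ conwayStableLattice N := by
    refine le_sSup ⟨(Submodule.span_singleton_le_iff_mem _ _).mpr D.f_mem_integralCuspForms0, ?_, ?_⟩
    · intro p hp hpN
      obtain ⟨ε, hε, hw⟩ := IsNewform0.exists_atkinLehnerInvolutionAt_eq_smul_holds D.isNewformOf.1 hp hpN
      rw [Submodule.map_le_iff_le_comap, Submodule.span_singleton_le_iff_mem, Submodule.mem_comap]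
      show atkinLehnerInvolutionAt N 2 p D.f ∈ ℤ ∙ D.f
      rw [hw]
      rcases hε with rfl | rfl
      · rw [one_smul]; exact Submodule.mem_span_singleton_self D.f
      · rw [neg_one_smul]; exact Submodule.neg_mem _ (Submodule.mem_span_singleton_self D.f)
    · rw [Submodule.map_le_iff_le_comap, Submodule.span_singleton_le_iff_mem, Submodule.mem_comap]
      show halfTranslate N 2 D.f ∈ ℤ ∙ D.f
      rw [halfTranslate_two_newform h4]
      exact Submodule.neg_mem _ (Submodule.mem_span_singleton_self D.f)
  exact hspan (Submodule.mem_span_singleton_self D.f)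

/-- **The newform lies in the Ramanujan-stable lattice `S^R`** (`9 ∣ N`): `ℤf` is integral, `w_{Q_p}`-stable and
`R₃`-stable (`R₃ f = −f`). -/
theorem f_mem_ramanujanStableLattice (h9 : 9 ∣ N) (D : ModularParametrizationData W N) :
    D.f ∈ ramanujanStableLattice N := by
  have hspan : (ℤ ∙ D.f) ≤ ramanujanStableLattice N := by
    refine le_sSup ⟨(Submodule.span_singleton_le_iff_mem _ _).mpr D.f_mem_integralCuspForms0, ?_, ?_⟩
    · intro p hp hpN
      obtain ⟨ε, hε, hw⟩ := IsNewform0.exists_atkinLehnerInvolutionAt_eq_smul_holds D.isNewformOf.1 hp hpN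
      rw [Submodule.map_le_iff_le_comap, Submodule.span_singleton_le_iff_mem, Submodule.mem_comap]
      show atkinLehnerInvolutionAt N 2 p D.f ∈ ℤ ∙ D.f
      rw [hw]
      rcases hε with rfl | rfl
      · rw [one_smul]; exact Submodule.mem_span_singleton_self D.f
      · rw [neg_one_smul]; exact Submodule.neg_mem _ (Submodule.mem_span_singleton_self D.f)
    · rw [Submodule.map_le_iff_le_comap, Submodule.span_singleton_le_iff_mem, Submodule.mem_comap]
      show ramanujanThree N 2 D.f ∈ ℤ ∙ D.f
      rw [ramanujanThree_two_newform h9]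
      exact Submodule.neg_mem _ (Submodule.mem_span_singleton_self D.f)
  exact hspan (Submodule.mem_span_singleton_self D.f)

end Newform

end Summit.BirchSwinnertonDyer.BirchSwinnertonDyer.Theorems.ManinLocalTwoThree

end
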